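import Literature.NumberTheory.Sieve.LinearEquationsInPrimesHostKraCubes
import Literature.NumberTheory.Sieve.LinearEquationsInPrimesNilsequences
import Mathlib.Topology.Algebra.Group.Quotient
import Mathlib.Topology.Algebra.Group.Basic
import Mathlib.Topology.Homeomorph.Lemmas
import Mathlib.Topology.MetricSpace.Defs
import Mathlib.Topology.ContinuousMap.StoneWeierstrass
import HarnessLib

/-!
# Linear equations in primes: the Host–Kra cube space of a nilmanifold and the parallelepiped
# constraint (Green–Tao 2010, Prop. 11.5, App. E (Lemmas E.9–E.10), and the Stone–Weierstrass
# step of Prop. 11.2)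

Trunk T-SIEVE (`Literature/NumberTheory/Sieve`), continuing
`LinearEquationsInPrimesHostKraCubes.lean` (the algebra of the Host–Kra cube groups) in the
inline decomposition of the named fact `Literature.NumberTheory.Sieve.GreenTao2010_gowersUniformity`
(B. Green, T. Tao, *Linear equations in primes*, Ann. of Math. 171 (2010), Thm. 7.2) at levels
`s ≥ 2`, whose §11 input "nilsequences obstruct uniformity" (Cor. 11.6,
`GreenTao2010_nilObstructionAt`) rests on the parallelepiped constraint Prop. 11.5. This file
proves Prop. 11.5 and the Stone–Weierstrass step of Prop. 11.2 for every nilmanifold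
`X = G/Γ : Nilmanifold s` whose lower central series is *rational* with respect to `Γ`
(Lemma E.9 of the paper, carried as a hypothesis — see below):

* `HostKra.RationalAt G_• Γ j` / `Nilmanifold.IsRationalAt X j` / `Nilmanifold.IsRational X` —
  "`Γ ∩ G_j` is cocompact in `G_j`" (a compact `K ⊆ G_j` with `G_j = K (Γ ∩ G_j)`), the
  conclusion of Lemma E.9; automatic at the levels `j = 0, 1` (`Γ` cocompact in the locally
  compact `G`, `rationalAt_of_eq_top`) and `j > s` (`G_j = {1}`), so that `X.IsRational` reduces
  to `2 ≤ j ≤ s` (`isRational_iff`) and holds outright for `s ≤ 1` (`isRational_of_le_one`);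
* Lemma E.10 in recursive form (`HostKra.exists_compact_transversal`): if all levels are
  rational, `HK^k(G_•)` has a compact transversal for `Γ^{{0,1}^k} ∩ HK^k(G_•)` — by induction
  on `k` through `mem_HK_succ_iff`, `𝒦^{(k+1)} = double(𝒦^{(k)}(G_•)) · upper(𝒦^{(k)}(G_•^{+1}))`
  (the paper argues along the ordered factorisation (E.1) instead);
* the **cube space** `Nilmanifold.cubeSpace X ⊆ (G/Γ)^{{0,1}^{s+1}}`, the image of
  `HK^{s+1}(G_•)` (the Host–Kra nilmanifold of Def. E.8 "as a compact subset" of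
  `(G/Γ)^{{0,1}^{s+1}}`): compact (`isCompact_cubeSpace`), containing all parallelepipeds
  `(g^{n + ω·h} x)_ω` (`parallelepiped_mem_cubeSpace`, Lemma E.4), and with the corner `0^{s+1}`
  determined by the other vertices (`cubeSpace_apply_bot_eq`, Lemma E.7);
* **Prop. 11.5 as printed** (`Nilmanifold.parallelepipedConstraint`): a compact
  `Σ ⊆ (G/Γ)^{{0,1}^{s+1}_*}` and a `P` continuous on `Σ` with `(x_ω)_{ω ≠ 0} ∈ Σ` and
  `x_{0^{s+1}} = P((x_ω)_{ω ≠ 0})` for every parallelepiped (`Σ` = punctured cube space, `P` =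
  corner of the inverse of the restriction homeomorphism, `Continuous.homeoOfEquivCompactToT2`);
* the **Stone–Weierstrass step of the proof of Prop. 11.2** (`exists_vertexProd_near`,
  `exists_vertexProd_near_orbit`): for continuous `F` and `ε > 0`, finitely many coefficients
  `c_i` and `1`-bounded continuous `H_{i,ω} : G/Γ → ℝ`, `ω ∈ {0,1}^{s+1}_*`, with
  `|F(g^m x) - ∑_i c_i ∏_{ω ≠ 0} H_{i,ω}(g^{m + ω·h} x)| ≤ ε` for all `g, x, m, h` — Stone–Weierstrass
  (Mathlib) on the compact cube space for the subalgebra generated by the vertex evaluations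
  `y ↦ H(y_ω)`, `ω ≠ 0^{s+1}`, which separates points exactly by the corner constraint.

## The rationality hypothesis (Lemma E.9)

Lemma E.9 ("Let `G` be a connected, simply-connected nilpotent Lie group, and let `Γ` be a
discrete cocompact subgroup. Then for any `j ≥ 1` the group `Γ ∩ G_j` is discrete and cocompact in
`G_j`.") is a theorem of Mal'cev (1949) valid for every nilmanifold; its proof goes through the
Lie correspondence and Mal'cev coordinates, which Mathlib does not have, and the abstract
structure `Nilmanifold s` of this series (a Lie group with a compatible metric on `G/Γ`) offers no
substitute. The results here therefore take `X.IsRational` as an explicit hypothesis — a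
property of `X`, not an assumption on the conclusion: it is vacuous for `s ≤ 1`, and for the
Heisenberg nilmanifolds relevant to `s = 2` "Lemma E.9 can easily be verified by hand" (Remark
after Lemma E.9). Discreteness of `Γ ∩ G_j` is automatic and not recorded.

## Design notes

* `G/Γ` carries the quotient topology; the bundled metric `X.dist` induces it (`X.isOpen_iff`),
  which gives a `MetricSpace` structure on the same topology (`Nilmanifold.metricSpace`, Mathlib's
  `MetricSpace.ofDistTopology`) and hence `T2Space (G/Γ)`; `G` is locally compact as a
  finite-dimensional manifold. These are the only uses of the Lie structure.
* Vertices are `Fin (s+1) → Bool` as in `…HostKraCubes.lean`; the punctured cube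
  `{0,1}^{s+1}_*` is the subtype `PuncturedVertex`; `ω·h` is `HostKra.dot` / `HostKra.dotNat`.
* Not here: the averaging/Gowers–Cauchy–Schwarz half of Prop. 11.2 and Cor. 11.6 (sequel), the
  Lipschitz refinement of the tensor factors (only boundedness and continuity are recorded), and
  Lemma E.9 itself.

## References

* B. Green, T. Tao, *Linear equations in primes*, Ann. of Math. (2) 171 (2010), 1753–1850
  (arXiv:math/0606088): §11 (Def. 11.4, Prop. 11.5, proof of Prop. 11.2), App. E (Def. E.8,
  Lemmas E.4, E.7, E.9, E.10, proof of Prop. 11.5).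
* A. I. Mal'cev, *On a class of homogeneous spaces*, Izv. Akad. Nauk SSSR 13 (1949); AMS Transl.
  39 (1951) (Lemma E.9; cited through Green–Tao).
-/

noncomputable section

namespace Literature.NumberTheory.Sieve

namespace HostKra

open Set

variable {G : Type*} [Group G]
variable {k : ℕ}

/-- Every vertex of an element of `HK^k(G_•)` lies in `G_0` (the generators do, `G_•` being
decreasing). [cite: GreenTao2010, App. E, Def. E.3] -/
theorem apply_mem_zero {G_ : ℕ → Subgroup G} (hG : IsFiltration G_) {c : Vertex k → G}
    (hc : c ∈ HK k G_) (ω : Vertex k) : c ω ∈ G_ 0 := by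
  have : HK k G_ ≤ (G_ 0).comap (Pi.evalMonoidHom (fun _ => G) ω) := by
    refine (Subgroup.closure_le _).mpr ?_
    rintro _ ⟨σ, g, hg, rfl⟩
    change faceElt σ g ω ∈ G_ 0
    rw [faceElt_apply]
    split_ifs
    · exact hG.antitone (Nat.zero_le _) hg
    · exact one_mem _
  exact this hc

/-- "`Γ ∩ G_j` is cocompact in `G_j`", for a filtration `G_•` and a subgroup `Γ` of a topological
group: a compact `K ⊆ G_j` with `G_j = K · (Γ ∩ G_j)` (the conclusion of Lemma E.9 at level `j`,
as a predicate). [cite: GreenTao2010, App. E, Lemma E.9] -/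
def RationalAt [TopologicalSpace G] (G_ : ℕ → Subgroup G) (Γ : Subgroup G) (j : ℕ) : Prop :=
  ∃ K : Set G, IsCompact K ∧ K ⊆ (G_ j : Set G) ∧ ∀ y ∈ G_ j, ∃ x ∈ K, x⁻¹ * y ∈ Γ

variable [TopologicalSpace G]

/-- Levels where the filtration is trivial are trivially rational (`K = {1}`). [folklore] -/
theorem rationalAt_of_eq_bot {G_ : ℕ → Subgroup G} {Γ : Subgroup G} {j : ℕ} (h : G_ j = ⊥) :
    RationalAt G_ Γ j :=
  ⟨{1}, isCompact_singleton, by simp, fun y hy =>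
    ⟨1, rfl, by rw [h, Subgroup.mem_bot] at hy; simp [hy]⟩⟩

/-- Doubling is continuous. [folklore] -/
theorem continuous_doubleHom :
    Continuous (doubleHom k : (Vertex k → G) → (Vertex (k + 1) → G)) :=
  continuous_pi fun ω => continuous_apply (Fin.tail ω)

/-- Placing on the upper half is continuous. [folklore] -/
theorem continuous_upperHom :
    Continuous (upperHom k : (Vertex k → G) → (Vertex (k + 1) → G)) := by
  refine continuous_pi fun ω => ?_
  by_cases h : ω 0 = true
  · simp only [upperHom_apply, h, if_true]; exact continuous_apply _
  · simp only [upperHom_apply, h]; exact continuous_const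

variable [IsTopologicalGroup G]

/-- If `Γ` is cocompact in the locally compact group `G` (`G/Γ` compact) then every level with
`G_j = G` is rational: finitely many compact neighbourhoods cover `G` modulo `Γ`. [folklore] -/
theorem rationalAt_of_eq_top [LocallyCompactSpace G] {G_ : ℕ → Subgroup G} {Γ : Subgroup G}
    [CompactSpace (G ⧸ Γ)] {j : ℕ} (h : G_ j = ⊤) : RationalAt G_ Γ j := by
  choose K hKc hKn using fun x : G => exists_compact_mem_nhds x
  have hcover : (univ : Set (G ⧸ Γ)) ⊆ ⋃ x : G, QuotientGroup.mk '' interior (K x) := by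
    rintro q -
    obtain ⟨x, rfl⟩ := QuotientGroup.mk_surjective q
    exact mem_iUnion.mpr ⟨x, x, mem_interior_iff_mem_nhds.mpr (hKn x), rfl⟩
  obtain ⟨t, ht⟩ := isCompact_univ.elim_finite_subcover _
    (fun x => QuotientGroup.isOpenMap_coe _ isOpen_interior) hcover
  refine ⟨⋃ x ∈ t, K x, t.isCompact_biUnion fun x _ => hKc x, by simp [h], fun y _ => ?_⟩
  obtain ⟨x, hx, z, hz, hzy⟩ : ∃ x ∈ t, ∃ z ∈ interior (K x), (z : G ⧸ Γ) = y := by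
    simpa using ht (mem_univ (y : G ⧸ Γ))
  exact ⟨z, mem_biUnion hx (interior_subset hz), QuotientGroup.eq.mp hzy⟩

/-- **Lemma E.10, recursive form**: if every level of the filtration is rational with respect to
`Γ`, then `Γ^{{0,1}^k} ∩ HK^k(G_•)` is cocompact in `HK^k(G_•)`: there is a compact
`𝒦 ⊆ HK^k(G_•)` such that every `c ∈ HK^k(G_•)` is `a · γ` with `a ∈ 𝒦`, `γ ∈ Γ^{{0,1}^k}`
(induction on `k` through `mem_HK_succ_iff`: `𝒦^{(k+1)} = double(𝒦^{(k)}(G_•)) · upper(𝒦^{(k)}(G_•^{+1}))`,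
using that `HK^k(G_•)` normalises `HK^k(G_•^{+1})`). [cite: GreenTao2010, App. E, Lemma E.10] -/
theorem exists_compact_transversal {Γ : Subgroup G} :
    ∀ {G_ : ℕ → Subgroup G}, IsFiltration G_ → (∀ j, RationalAt G_ Γ j) →
      ∃ 𝒦 : Set (Vertex k → G), IsCompact 𝒦 ∧ 𝒦 ⊆ (HK k G_ : Set (Vertex k → G)) ∧
        ∀ c ∈ HK k G_, ∃ a ∈ 𝒦, ∀ ω, (a ω)⁻¹ * c ω ∈ Γ := by
  induction k with
  | zero =>
    intro G_ hG hR
    obtain ⟨K, hKc, hKG, hK⟩ := hR 0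
    refine ⟨(fun x => fun _ => x) '' K, hKc.image (continuous_pi fun _ => continuous_id), ?_, ?_⟩
    · rintro _ ⟨x, hx, rfl⟩
      exact const_mem_HK (hKG hx)
    · intro c hc
      obtain ⟨x, hx, hxy⟩ := hK _ (apply_mem_zero hG hc default)
      refine ⟨fun _ => x, ⟨x, hx, rfl⟩, fun ω => ?_⟩
      rw [Subsingleton.elim ω default]
      exact hxy
  | succ k ih =>
    intro G_ hG hR
    obtain ⟨𝒦₁, h1c, h1s, h1⟩ := ih hG hR
    obtain ⟨𝒦₂, h2c, h2s, h2⟩ := ih hG.shift fun j => hR (j + 1)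
    refine ⟨(fun p => doubleHom k p.1 * upperHom k p.2) '' (𝒦₁ ×ˢ 𝒦₂),
      (h1c.prod h2c).image ((continuous_doubleHom.comp continuous_fst).mul
        (continuous_upperHom.comp continuous_snd)), ?_, ?_⟩
    · rintro _ ⟨⟨a, d⟩, ⟨ha, hd⟩, rfl⟩
      exact mul_mem (doubleHom_mem (h1s ha)) (upperHom_mem (h2s hd))
    · intro c hc
      obtain ⟨hl, hδ⟩ := lowerHalf_mem hG hc
      obtain ⟨a, ha, hγ⟩ := h1 _ hl
      have hγmem : a⁻¹ * lowerHalf c ∈ HK k G_ := mul_mem (inv_mem (h1s ha)) hl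
      have hδ' := conj_mem_shift hG hγmem hδ
      obtain ⟨d, hd, hγ'⟩ := h2 _ hδ'
      refine ⟨doubleHom k a * upperHom k d, ⟨(a, d), ⟨ha, hd⟩, rfl⟩, fun ω => ?_⟩
      obtain ⟨b, ω', rfl⟩ : ∃ b ω', ω = Fin.cons b ω' :=
        ⟨ω 0, Fin.tail ω, (Fin.cons_self_tail ω).symm⟩
      cases b
      · simpa [doubleHom_apply, upperHom_apply] using hγ ω'
      · have key : (a ω' * d ω')⁻¹ * c (Fin.cons true ω') =
            ((d ω')⁻¹ * (a⁻¹ * lowerHalf c * ((lowerHalf c)⁻¹ * upperHalf c) *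
              (a⁻¹ * lowerHalf c)⁻¹) ω') * ((a ω')⁻¹ * lowerHalf c ω') := by
          simp only [Pi.mul_apply, Pi.inv_apply, lowerHalf_apply, upperHalf_apply]
          group
        have hmem : (a ω' * d ω')⁻¹ * c (Fin.cons true ω') ∈ Γ := by
          rw [key]
          exact mul_mem (hγ' ω') (hγ ω')
        simpa [doubleHom_apply, upperHom_apply] using hmem

end HostKra

/-! ### Nilmanifolds: rationality of the lower central series, the Host–Kra cube space -/

namespace Nilmanifold

open HostKra
open scoped Manifold

variable {s : ℕ} (X : Nilmanifold s)

/-- The Lie group of a nilmanifold is locally compact (a finite-dimensional manifold).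
[folklore] -/
instance instLocallyCompactSpace : LocallyCompactSpace X.G :=
  Manifold.locallyCompact_of_finiteDimensional 𝓘(ℝ, X.E)

/-- The metric space structure of `(G/Γ, d_{G/Γ})`, on the quotient topology. [folklore] -/
@[reducible] def metricSpace : MetricSpace (X.G ⧸ X.Γ) :=
  MetricSpace.ofDistTopology X.dist X.dist_self X.dist_comm X.dist_triangle
    (fun U => (X.isOpen_iff U).trans (by simp only [gt_iff_lt])) X.eq_of_dist_eq_zero

/-- A nilmanifold is Hausdorff (it is metrisable). [folklore] -/
instance instT2SpaceQuotient : T2Space (X.G ⧸ X.Γ) := by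
  letI := X.metricSpace
  infer_instance

/-- **Rationality of `G_j` with respect to `Γ`** (the conclusion of Lemma E.9 at level `j`):
`Γ ∩ G_j` is cocompact in `G_j`, i.e. there is a compact `K ⊆ G_j` with `G_j = K (Γ ∩ G_j)`.
[cite: GreenTao2010, App. E, Lemma E.9] -/
def IsRationalAt (j : ℕ) : Prop := RationalAt (lcs X.G) X.Γ j

/-- **Lemma E.9 (Mal'cev) for the nilmanifold `X`**, as a hypothesis: every `Γ ∩ G_j` is
cocompact in `G_j` ("Let `G` be a connected, simply-connected nilpotent Lie group, and let `Γ` be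
a discrete cocompact subgroup. Then for any `j ≥ 1` the group `Γ ∩ G_j` is discrete and
cocompact in `G_j`."). This is a theorem of Mal'cev for every nilmanifold; its proof needs the
Lie correspondence (Mal'cev coordinates), absent from Mathlib, so the files of this series carry
it as an explicit hypothesis on `X` — automatic for `j ∈ {0, 1}` and `j > s`
(`isRational_iff`), hence vacuous for `s ≤ 1`, and "easily verified by hand" for the Heisenberg
examples relevant to `s = 2` (Remark after Lemma E.9). [cite: GreenTao2010, App. E, Lemma E.9] -/
def IsRational (X : Nilmanifold s) : Prop := ∀ j, X.IsRationalAt j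

/-- `G_0 = G` is rational: `Γ` is cocompact in `G`. [folklore] -/
theorem isRationalAt_zero : X.IsRationalAt 0 := rationalAt_of_eq_top lcs_zero

/-- `G_1 = G` is rational: `Γ` is cocompact in `G`. [folklore] -/
theorem isRationalAt_one : X.IsRationalAt 1 := rationalAt_of_eq_top lcs_one

/-- `G_j = {1}` for `j > s` is rational. [folklore] -/
theorem isRationalAt_of_lt {j : ℕ} (hj : s < j) : X.IsRationalAt j := by
  refine rationalAt_of_eq_bot (le_bot_iff.mp ?_)
  calc lcs X.G j ≤ lcs X.G (s + 1) := isFiltration_lcs.antitone (by omega)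
    _ = ⊥ := lcs_eq_bot X.lowerCentralSeries_eq_bot

/-- Lemma E.9 for `X` reduces to the levels `2 ≤ j ≤ s`. [folklore] -/
theorem isRational_iff : X.IsRational ↔ ∀ j, 2 ≤ j → j ≤ s → X.IsRationalAt j := by
  refine ⟨fun h j _ _ => h j, fun h j => ?_⟩
  rcases Nat.lt_or_ge s j with hj | hj
  · exact X.isRationalAt_of_lt hj
  rcases j with _ | _ | j
  · exact X.isRationalAt_zero
  · exact X.isRationalAt_one
  · exact h _ (by omega) hj

/-- For `s ≤ 1` (in particular for `1`-step nilmanifolds) Lemma E.9 is automatic. [folklore] -/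
theorem isRational_of_le_one (hs : s ≤ 1) : X.IsRational :=
  X.isRational_iff.mpr fun j h2 hj => absurd (h2.trans hj) (by omega)

/-- **The Host–Kra cube space** of the nilmanifold: the image `Σ'` of `HK^{s+1}(G_•)` in
`(G/Γ)^{{0,1}^{s+1}}` (the Host–Kra nilmanifold `HK^{s+1}(G_•)/(Γ^{{0,1}^{s+1}} ∩ HK^{s+1}(G_•))`
of Def. E.8, "as a compact subset of" `(G/Γ)^{{0,1}^{s+1}}`).
[cite: GreenTao2010, App. E, Def. E.8 and proof of Prop. 11.5] -/
def cubeSpace : Set (Vertex (s + 1) → X.G ⧸ X.Γ) :=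
  (fun c ω => (c ω : X.G ⧸ X.Γ)) '' (HK (s + 1) (lcs X.G) : Set (Vertex (s + 1) → X.G))

/-- The cube space is compact when the lower central series is rational (Lemma E.10: it is the
image of the compact transversal `𝒦`). [cite: GreenTao2010, App. E, Lemma E.10] -/
theorem isCompact_cubeSpace (hX : X.IsRational) : IsCompact X.cubeSpace := by
  obtain ⟨𝒦, h𝒦c, h𝒦s, h𝒦⟩ := exists_compact_transversal (k := s + 1) isFiltration_lcs hX
  have e : X.cubeSpace = (fun c ω => (c ω : X.G ⧸ X.Γ)) '' 𝒦 := by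
    apply Set.Subset.antisymm
    · rintro _ ⟨c, hc, rfl⟩
      obtain ⟨a, ha, hγ⟩ := h𝒦 c hc
      refine ⟨a, ha, funext fun ω => ?_⟩
      change (a ω : X.G ⧸ X.Γ) = (c ω : X.G ⧸ X.Γ)
      exact QuotientGroup.eq.mpr (hγ ω)
    · exact Set.image_mono h𝒦s
  rw [e]
  exact h𝒦c.image (continuous_pi fun ω => QuotientGroup.continuous_mk.comp (continuous_apply ω))

/-- Parallelepipeds `(g^{n + ω·h} x)_{ω ∈ {0,1}^{s+1}}`, `g ∈ G`, `x ∈ G/Γ`, lie in the cube space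
(Lemma E.4). [cite: GreenTao2010, App. E, Lemma E.4] -/
theorem parallelepiped_mem_cubeSpace (g : X.G) (x : X.G ⧸ X.Γ) (n : ℤ) (h : Fin (s + 1) → ℤ) :
    (fun ω : Vertex (s + 1) => g ^ (n + dot ω h) • x) ∈ X.cubeSpace := by
  obtain ⟨x₀, rfl⟩ := QuotientGroup.mk_surjective x
  refine ⟨fun ω => g ^ (n + dot ω h) * x₀, parallelepiped_mem_HK_lcs g x₀ n h,
    funext fun ω => ?_⟩
  change ((g ^ (n + dot ω h) * x₀ : X.G) : X.G ⧸ X.Γ) = g ^ (n + dot ω h) • (x₀ : X.G ⧸ X.Γ)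
  rw [MulAction.Quotient.smul_mk, smul_eq_mul]

/-- **The corner constraint in `G/Γ`**: two points of the cube space agreeing at every vertex
`ω ≠ 0^{s+1}` agree at `0^{s+1}` (Lemma E.7). [cite: GreenTao2010, App. E, proof of Prop. 11.5] -/
theorem cubeSpace_apply_bot_eq {y y' : Vertex (s + 1) → X.G ⧸ X.Γ} (hy : y ∈ X.cubeSpace)
    (hy' : y' ∈ X.cubeSpace) (h : ∀ ω, ω ≠ (fun _ => false) → y ω = y' ω) :
    y (fun _ => false) = y' (fun _ => false) := by
  obtain ⟨c, hc, rfl⟩ := hy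
  obtain ⟨c', hc', rfl⟩ := hy'
  exact quotient_apply_bot_eq isFiltration_lcs (lcs_eq_bot X.lowerCentralSeries_eq_bot) X.Γ hc hc' h

/-- The punctured cube `{0,1}^{s+1}_* = {0,1}^{s+1} ∖ {0^{s+1}}`. [cite: GreenTao2010, §11 (before Prop. 11.5)] -/
abbrev PuncturedVertex (k : ℕ) := {ω : Vertex k // ω ≠ fun _ => false}

/-- Restriction of a configuration to the punctured cube. [folklore] -/
def restrict {α : Type*} (y : Vertex (s + 1) → α) : PuncturedVertex (s + 1) → α := fun ω => y ω.1

/-- **Prop. 11.5 (Parallelepiped constraint), as printed**, for a nilmanifold whose lower central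
series is rational: "There exists a compact set `Σ ⊆ (G/Γ)^{{0,1}^{s+1}_*}` and a continuous
function `P : Σ → G/Γ` such that, for any `(s+1)`-dimensional parallelepiped
`(x_ω)_{ω ∈ {0,1}^{s+1}}`, we have `(x_ω)_{ω ∈ {0,1}^{s+1}_*} ∈ Σ` and the constraint
`x_{0^{s+1}} = P((x_ω)_{ω ∈ {0,1}^{s+1}_*})`." (`P` is a function on all of
`(G/Γ)^{{0,1}^{s+1}_*}`, continuous on `Σ`; parallelepipeds are `(g^{n + ω·h} x)_ω`, Def. 11.4.)
[cite: GreenTao2010, Prop. 11.5] -/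
theorem parallelepipedConstraint (hX : X.IsRational) :
    ∃ S : Set (PuncturedVertex (s + 1) → X.G ⧸ X.Γ), IsCompact S ∧
      ∃ P : (PuncturedVertex (s + 1) → X.G ⧸ X.Γ) → X.G ⧸ X.Γ, ContinuousOn P S ∧
        ∀ (g : X.G) (x : X.G ⧸ X.Γ) (n : ℤ) (h : Fin (s + 1) → ℤ),
          restrict (fun ω : Vertex (s + 1) => g ^ (n + dot ω h) • x) ∈ S ∧
            g ^ n • x = P (restrict fun ω : Vertex (s + 1) => g ^ (n + dot ω h) • x) := by
  classical
  set T := X.cubeSpace with hT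
  have hc : IsCompact T := X.isCompact_cubeSpace hX
  -- the restriction map is injective on T
  have hinj : Set.InjOn (restrict (s := s)) T := by
    intro y hy y' hy' hyy'
    funext ω
    by_cases hω : ω = fun _ => false
    · subst hω
      exact X.cubeSpace_apply_bot_eq hy hy' fun ω hω => congr_fun hyy' ⟨ω, hω⟩
    · exact congr_fun hyy' ⟨ω, hω⟩
  have hres : Continuous (restrict (s := s) (α := X.G ⧸ X.Γ)) :=
    continuous_pi fun ω => continuous_apply ω.1
  refine ⟨restrict '' T, hc.image hres, ?_⟩
  -- P := corner of the preimage
  let e : T ≃ restrict '' T :=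
    Equiv.ofBijective (fun y => ⟨restrict y.1, y.1, y.2, rfl⟩)
      ⟨fun y y' hyy' => Subtype.ext (hinj y.2 y'.2 (congrArg Subtype.val hyy')),
        fun ⟨z, y, hy, hyz⟩ => ⟨⟨y, hy⟩, Subtype.ext hyz⟩⟩
  haveI : CompactSpace T := isCompact_iff_compactSpace.mp hc
  have he : Continuous e := (hres.comp continuous_subtype_val).subtype_mk _
  let Φ : T ≃ₜ restrict '' T := he.homeoOfEquivCompactToT2 (f := e)
  refine ⟨fun z => if hz : z ∈ restrict '' T then (Φ.symm ⟨z, hz⟩).1 (fun _ => false)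
      else ((1 : X.G) : X.G ⧸ X.Γ), ?_, ?_⟩
  · rw [continuousOn_iff_continuous_restrict]
    have : (restrict '' T).restrict (fun z => if hz : z ∈ restrict '' T then
        (Φ.symm ⟨z, hz⟩).1 (fun _ => false) else ((1 : X.G) : X.G ⧸ X.Γ)) =
        fun z => (Φ.symm z).1 (fun _ => false) := by
      funext z
      simp only [Set.restrict_apply, dif_pos z.2]
    rw [this]
    exact (continuous_apply _).comp (continuous_subtype_val.comp Φ.symm.continuous)
  · intro g x n h
    have hy : (fun ω : Vertex (s + 1) => g ^ (n + dot ω h) • x) ∈ T :=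
      X.parallelepiped_mem_cubeSpace g x n h
    have hz : restrict (fun ω : Vertex (s + 1) => g ^ (n + dot ω h) • x) ∈ restrict '' T :=
      ⟨_, hy, rfl⟩
    refine ⟨hz, ?_⟩
    simp only [dif_pos hz]
    have hΦ : Φ.symm ⟨_, hz⟩ = ⟨_, hy⟩ := by
      rw [Homeomorph.symm_apply_eq]
      rfl
    rw [hΦ]
    simp [dot]

/-! ### Stone–Weierstrass on the cube space: vertex-product approximation (proof of Prop. 11.2) -/

/-- The cube space of a rational nilmanifold is a compact space. [cite: GreenTao2010, App. E, Lemma E.10] -/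
theorem compactSpace_cubeSpace (hX : X.IsRational) : CompactSpace X.cubeSpace :=
  isCompact_iff_compactSpace.mp (X.isCompact_cubeSpace hX)

/-- The evaluation `y ↦ H(y_ω)` at a vertex `ω ≠ 0^{s+1}`, a continuous function on the cube
space (the "tensor factors" of the Stone–Weierstrass step). [cite: GreenTao2010, §11, proof of Prop. 11.2] -/
def vertexEval (ω : PuncturedVertex (s + 1)) (H : C(X.G ⧸ X.Γ, ℝ)) : C(X.cubeSpace, ℝ) :=
  ⟨fun y => H (y.1 ω.1), H.continuous.comp ((continuous_apply ω.1).comp continuous_subtype_val)⟩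

/-- A tensor product `y ↦ ∏_{ω ≠ 0^{s+1}} H_ω(y_ω)` on the cube space.
[cite: GreenTao2010, §11, proof of Prop. 11.2] -/
def vertexProd (H : PuncturedVertex (s + 1) → C(X.G ⧸ X.Γ, ℝ)) : C(X.cubeSpace, ℝ) :=
  ⟨fun y => ∏ ω, H ω (y.1 ω.1), continuous_finsetProd _ fun ω _ =>
    (H ω).continuous.comp ((continuous_apply ω.1).comp continuous_subtype_val)⟩

/-- `vertexEval`, evaluated. [folklore] -/
@[simp] theorem vertexEval_apply (ω : PuncturedVertex (s + 1)) (H : C(X.G ⧸ X.Γ, ℝ))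
    (y : X.cubeSpace) : X.vertexEval ω H y = H (y.1 ω.1) := rfl

/-- `vertexProd`, evaluated. [folklore] -/
@[simp] theorem vertexProd_apply (H : PuncturedVertex (s + 1) → C(X.G ⧸ X.Γ, ℝ))
    (y : X.cubeSpace) : X.vertexProd H y = ∏ ω, H ω (y.1 ω.1) := rfl

/-- The subalgebra of `C(Σ', ℝ)` generated by the vertex evaluations `y ↦ H(y_ω)`,
`ω ≠ 0^{s+1}`, `H ∈ C(G/Γ, ℝ)`. [cite: GreenTao2010, §11, proof of Prop. 11.2] -/
def cubeAlgebra : Subalgebra ℝ C(X.cubeSpace, ℝ) :=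
  Algebra.adjoin ℝ (Set.range fun p : PuncturedVertex (s + 1) × C(X.G ⧸ X.Γ, ℝ) =>
    X.vertexEval p.1 p.2)

/-- The vertex evaluations at `ω ≠ 0^{s+1}` separate the points of the cube space — this is
where the corner constraint (Lemma E.7 / Prop. 11.5) enters: two cubes with the same punctured
part are equal. [cite: GreenTao2010, §11, proof of Prop. 11.2] -/
theorem cubeAlgebra_separatesPoints : X.cubeAlgebra.SeparatesPoints := by
  letI := X.metricSpace
  intro y y' hne
  have hex : ∃ ω : PuncturedVertex (s + 1), y.1 ω.1 ≠ y'.1 ω.1 := by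
    by_contra hall
    push Not at hall
    apply hne
    apply Subtype.ext
    funext ω
    by_cases hω : ω = fun _ => false
    · subst hω
      exact X.cubeSpace_apply_bot_eq y.2 y'.2 fun ω hω => hall ⟨ω, hω⟩
    · exact hall ⟨ω, hω⟩
  obtain ⟨ω, hω⟩ := hex
  refine ⟨X.vertexEval ω ⟨fun z => Dist.dist z (y.1 ω.1), continuous_id.dist continuous_const⟩,
    ⟨_, Algebra.subset_adjoin ⟨(ω, _), rfl⟩, rfl⟩, ?_⟩
  simp only [vertexEval, ContinuousMap.coe_mk, _root_.dist_self, ne_eq]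
  intro h
  exact hω (_root_.dist_eq_zero.mp (Eq.symm h)).symm

/-- Every element of the cube algebra is a finite linear combination of tensor products
`∏_{ω ≠ 0^{s+1}} H_ω(y_ω)`. [folklore] -/
theorem exists_sum_vertexProd_of_mem {Ψ : C(X.cubeSpace, ℝ)} (hΨ : Ψ ∈ X.cubeAlgebra) :
    ∃ (n : ℕ) (c : Fin n → ℝ) (H : Fin n → PuncturedVertex (s + 1) → C(X.G ⧸ X.Γ, ℝ)),
      Ψ = ∑ i, c i • X.vertexProd (H i) := by
  classical
  set S := Set.range fun p : PuncturedVertex (s + 1) × C(X.G ⧸ X.Γ, ℝ) => X.vertexEval p.1 p.2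
  have hspan : Ψ ∈ Submodule.span ℝ (Submonoid.closure S : Set C(X.cubeSpace, ℝ)) := by
    have e := Algebra.adjoin_eq_span (R := ℝ) S
    rw [← e]
    exact hΨ
  obtain ⟨n, c, g, hsum⟩ := Submodule.mem_span_set'.mp hspan
  have hvp' : ∀ Ψ ∈ Submonoid.closure S, ∃ H : PuncturedVertex (s + 1) → C(X.G ⧸ X.Γ, ℝ),
      Ψ = X.vertexProd H := by
    intro Ψ hΨ
    induction hΨ using Submonoid.closure_induction with
    | mem x hx =>
      obtain ⟨⟨ω, H⟩, rfl⟩ := hx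
      refine ⟨Function.update (fun _ => 1) ω H, ?_⟩
      ext y
      rw [vertexEval_apply, vertexProd_apply, Finset.prod_eq_single ω]
      · simp
      · intro ω' _ hne
        simp [Function.update_of_ne hne]
      · simp
    | one => exact ⟨fun _ => 1, by ext y; simp⟩
    | mul Ψ₁ Ψ₂ _ _ h₁ h₂ =>
      obtain ⟨H₁, rfl⟩ := h₁
      obtain ⟨H₂, rfl⟩ := h₂
      exact ⟨fun ω => H₁ ω * H₂ ω, by ext y; simp [Finset.prod_mul_distrib]⟩
  have hvp : ∀ i, ∃ H : PuncturedVertex (s + 1) → C(X.G ⧸ X.Γ, ℝ),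
      (g i : C(X.cubeSpace, ℝ)) = X.vertexProd H := fun i => hvp' _ (g i).2
  choose H hH using hvp
  refine ⟨n, c, H, ?_⟩
  rw [← hsum]
  exact Finset.sum_congr rfl fun i _ => by rw [hH i]

/-- **Vertex-product approximation** (the Stone–Weierstrass step of the proof of Prop. 11.2:
"we may approximate this function to uniform accuracy `O(ε)` by a finite linear combination
of tensor products of bounded … functions on `G/Γ`, obtaining the uniform approximation
`F(P(x)) = ∑_{α ∈ A} ∏_{ω ∈ {0,1}^{s+1}_*} H_{ω,α}(x_ω) + O(ε)`"): for a rational nilmanifold,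
a continuous `F` and `ε > 0` there are finitely many coefficients `c_i` and `1`-bounded
continuous `H_{i,ω}` with `|F(y_{0^{s+1}}) - ∑_i c_i ∏_{ω ≠ 0^{s+1}} H_{i,ω}(y_ω)| ≤ ε` on the
whole cube space. [cite: GreenTao2010, §11, proof of Prop. 11.2] -/
theorem exists_vertexProd_near (hX : X.IsRational) {F : X.G ⧸ X.Γ → ℝ} (hF : Continuous F)
    {ε : ℝ} (hε : 0 < ε) :
    ∃ (n : ℕ) (c : Fin n → ℝ) (H : Fin n → PuncturedVertex (s + 1) → X.G ⧸ X.Γ → ℝ),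
      (∀ i ω, Continuous (H i ω)) ∧ (∀ i ω z, |H i ω z| ≤ 1) ∧
        ∀ y ∈ X.cubeSpace,
          |F (y fun _ => false) - ∑ i, c i * ∏ ω, H i ω (y ω.1)| ≤ ε := by
  haveI := X.compactSpace_cubeSpace hX
  obtain ⟨Ψ, hΨ⟩ := ContinuousMap.exists_mem_subalgebra_near_continuous_of_separatesPoints
    X.cubeAlgebra X.cubeAlgebra_separatesPoints (fun y : X.cubeSpace => F (y.1 fun _ => false))
    (hF.comp ((continuous_apply _).comp continuous_subtype_val)) ε hε
  obtain ⟨n, c, H, hrep⟩ := X.exists_sum_vertexProd_of_mem Ψ.2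
  refine ⟨n, fun i => c i * ∏ ω, (‖H i ω‖ + 1), fun i ω z => (‖H i ω‖ + 1)⁻¹ * H i ω z,
    fun i ω => continuous_const.mul (H i ω).continuous, fun i ω z => ?_, fun y hy => ?_⟩
  · rw [abs_mul, abs_inv, abs_of_pos (by positivity), inv_mul_le_iff₀ (by positivity), mul_one]
    have h1 : |H i ω z| ≤ ‖H i ω‖ := by
      rw [← Real.norm_eq_abs]; exact (H i ω).norm_coe_le_norm z
    linarith
  · have hlt := hΨ ⟨y, hy⟩
    have hΨy : (Ψ : X.cubeSpace → ℝ) ⟨y, hy⟩ = ∑ i, c i * ∏ ω, H i ω (y ω.1) := by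
      have e := congrArg (fun f : C(X.cubeSpace, ℝ) => f ⟨y, hy⟩) hrep
      simpa [ContinuousMap.coe_sum] using e
    have hresc : ∀ i, (c i * ∏ ω, (‖H i ω‖ + 1)) *
        ∏ ω, ((‖H i ω‖ + 1)⁻¹ * H i ω (y ω.1)) = c i * ∏ ω, H i ω (y ω.1) := by
      intro i
      rw [Finset.prod_mul_distrib, mul_assoc, ← mul_assoc (∏ ω, (‖H i ω‖ + 1)),
        ← Finset.prod_mul_distrib, Finset.prod_congr rfl fun ω _ =>
          mul_inv_cancel₀ (show (‖H i ω‖ + 1) ≠ 0 by positivity)]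
      simp
    simp_rw [hresc]
    rw [← hΨy, abs_sub_comm]
    rw [Real.norm_eq_abs] at hlt
    exact hlt.le

/-- The vertex-product approximation along orbits: for all `g ∈ G`, `x ∈ G/Γ`, `m ∈ ℕ` and
`h ∈ ℕ^{s+1}`, `|F(g^m x) - ∑_i c_i ∏_{ω ≠ 0^{s+1}} H_{i,ω}(g^{m + ω·h} x)| ≤ ε`, uniformly ("In
particular, since `(g^{n + ω·h}x)_{ω ∈ {0,1}^{s+1}_*}` lies in `Σ` and the image of this point
under `P` is `gⁿx`"). [cite: GreenTao2010, §11, proof of Prop. 11.2] -/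
theorem exists_vertexProd_near_orbit (hX : X.IsRational) {F : X.G ⧸ X.Γ → ℝ}
    (hF : Continuous F) {ε : ℝ} (hε : 0 < ε) :
    ∃ (n : ℕ) (c : Fin n → ℝ) (H : Fin n → PuncturedVertex (s + 1) → X.G ⧸ X.Γ → ℝ),
      (∀ i ω, Continuous (H i ω)) ∧ (∀ i ω z, |H i ω z| ≤ 1) ∧
        ∀ (g : X.G) (x : X.G ⧸ X.Γ) (m : ℕ) (h : Fin (s + 1) → ℕ),
          |F (g ^ m • x) - ∑ i, c i * ∏ ω, H i ω (g ^ (m + dotNat ω.1 h) • x)| ≤ ε := by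
  obtain ⟨n, c, H, hHc, hH1, happrox⟩ := X.exists_vertexProd_near hX hF hε
  refine ⟨n, c, H, hHc, hH1, fun g x m h => ?_⟩
  have hy := X.parallelepiped_mem_cubeSpace g x m (fun i => (h i : ℤ))
  have key := happrox _ hy
  have e0 : g ^ ((m : ℤ) + dot (fun _ : Fin (s + 1) => false) fun i => (h i : ℤ)) • x = g ^ m • x := by
    simp [dot]
  have e1 : ∀ ω : PuncturedVertex (s + 1),
      g ^ ((m : ℤ) + dot ω.1 fun i => (h i : ℤ)) • x = g ^ (m + dotNat ω.1 h) • x := by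
    intro ω
    rw [dot_natCast, ← Nat.cast_add, zpow_natCast]
  simpa only [e0, e1] using key

end Nilmanifold

end Literature.NumberTheory.Sieve
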